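import Mathlib.Analysis.Normed.Module.Basic
import Mathlib.Analysis.SpecialFunctions.Exp
import Mathlib.Algebra.Order.BigOperators.Ring.Finset
import HarnessLib

/-!
# Perturbed non-expansive recursions: error transport «along the numerical solution»

Topic `Literature/Analysis/ODE` (everything proved; no definition, no named fact). The discrete error-transport
argument of Cauchy–Runge («method (b)», Lady Windermere's fan) [cite: HairerNorsettWanner1993, §II.3 Fig. 3.2,
(3.25), Thms 3.4–3.6] in the RELATIVE-error, non-expansive form in which it is used to compose a sequence of
contractions perturbed by feed-back terms: in a real normed space, a sequence `x (k+1) = M_k (x k) + e k` driven by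
non-expansive maps `‖M_k u‖ ≤ ‖u‖` (`M_k 0 = 0` is not even needed beyond this) with perturbations controlled by the
PAST trajectory, `‖e k‖ ≤ ε_k · C` whenever `‖x j‖ ≤ C` for all `j ≤ k` (`ε_k ≥ 0`), satisfies

* `norm_le_prod_norm₀` — `‖x n‖ ≤ (Π_{k<n} (1 + ε_k)) ‖x 0‖`;
* `norm_sub_unperturbed_le_prod` — against the UNPERTURBED recursion `y (k+1) = M_k (y k)`, `y 0 = x 0`, with the
  `M_k` non-expansive on differences (`‖M_k u − M_k w‖ ≤ ‖u − w‖`, e.g. linear):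
  `‖x n − y n‖ ≤ (Π_{k<n} (1 + ε_k) − 1) ‖x 0‖`;
* `norm_sub_unperturbed_le_exp` — the same with `Π(1 + ε_k) ≤ exp(Σ ε_k)`:
  `‖x n − y n‖ ≤ (exp (Σ_{k<n} ε_k) − 1) ‖x 0‖`.

(Use: the slow amplitudes across a period of slot maps, `M_k` = the slot propagator on the slow plane — non-expansive
by energy monotonicity — and `e k` = the feed of relaxed fast residues, proportional to earlier slow amplitudes.)
-/

namespace Literature.Analysis.ODE

namespace PerturbedRecursion

open Finset Real

variable {G : Type*} [NormedAddCommGroup G]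

/-- The partial products `Π_{k<n}(1 + ε_k)` are nonnegative for `ε_k ≥ 0`. [folklore] -/
private theorem prod_one_add_nonneg (ε : ℕ → ℝ) (hε : ∀ k, 0 ≤ ε k) (n : ℕ) :
    0 ≤ ∏ k ∈ range n, (1 + ε k) :=
  Finset.prod_nonneg fun k _ => by linarith [hε k]

/-- The partial products `Π_{k<n}(1 + ε_k)` are non-decreasing in `n` for `ε_k ≥ 0`. [folklore] -/
private theorem prod_one_add_mono (ε : ℕ → ℝ) (hε : ∀ k, 0 ≤ ε k) {j n : ℕ} (hjn : j ≤ n) :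
    ∏ k ∈ range j, (1 + ε k) ≤ ∏ k ∈ range n, (1 + ε k) := by
  induction n, hjn using Nat.le_induction with
  | base => exact le_rfl
  | succ n _ ih =>
    refine ih.trans ?_
    rw [Finset.prod_range_succ]
    exact le_mul_of_one_le_right (prod_one_add_nonneg ε hε n) (by linarith [hε n])

/-- **A priori growth**: `‖x n‖ ≤ (Π_{k<n}(1 + ε_k))‖x 0‖` for a non-expansive recursion with relative perturbations
controlled by the past trajectory. [cite: HairerNorsettWanner1993, §II.3 (3.25) (one-step propagation estimate)] -/
theorem norm_le_prod_norm₀ (M : ℕ → G → G) (x e : ℕ → G) (ε : ℕ → ℝ)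
    (hM : ∀ k u, ‖M k u‖ ≤ ‖u‖) (hε : ∀ k, 0 ≤ ε k)
    (hx : ∀ k, x (k + 1) = M k (x k) + e k)
    (he : ∀ k (C : ℝ), (∀ j ≤ k, ‖x j‖ ≤ C) → ‖e k‖ ≤ ε k * C) :
    ∀ n, ‖x n‖ ≤ (∏ k ∈ range n, (1 + ε k)) * ‖x 0‖ := by
  -- strengthen to a bound on the whole past
  have hPmono : ∀ n, ∀ j ≤ n, (∏ k ∈ range j, (1 + ε k)) ≤ ∏ k ∈ range n, (1 + ε k) :=
    fun n j hj => prod_one_add_mono ε hε hj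
  have key : ∀ n, ∀ j ≤ n, ‖x j‖ ≤ (∏ k ∈ range n, (1 + ε k)) * ‖x 0‖ := by
    intro n
    induction n with
    | zero =>
      intro j hj
      rw [Nat.le_zero.1 hj]
      simp
    | succ n ih =>
      intro j hj
      rcases Nat.lt_or_ge j (n + 1) with hlt | hge
      · have hjn : j ≤ n := Nat.lt_succ_iff.1 hlt
        refine (ih j hjn).trans ?_
        refine mul_le_mul_of_nonneg_right (hPmono (n + 1) n (Nat.le_succ n)) (norm_nonneg _)
      · have hj' : j = n + 1 := le_antisymm hj hge
        subst hj'
        rw [hx n, Finset.prod_range_succ]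
        have h1 : ‖M n (x n)‖ ≤ (∏ k ∈ range n, (1 + ε k)) * ‖x 0‖ := (hM n (x n)).trans (ih n le_rfl)
        have h2 : ‖e n‖ ≤ ε n * ((∏ k ∈ range n, (1 + ε k)) * ‖x 0‖) := he n _ ih
        calc ‖M n (x n) + e n‖ ≤ ‖M n (x n)‖ + ‖e n‖ := norm_add_le _ _
          _ ≤ (∏ k ∈ range n, (1 + ε k)) * ‖x 0‖ + ε n * ((∏ k ∈ range n, (1 + ε k)) * ‖x 0‖) := add_le_add h1 h2
          _ = (∏ k ∈ range n, (1 + ε k)) * (1 + ε n) * ‖x 0‖ := by ring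
  exact fun n => key n n le_rfl

/-- **Error transport along the perturbed recursion** (Lady Windermere's fan, relative form): against the unperturbed
recursion `y (k+1) = M_k (y k)` from the same datum, with `M_k` non-expansive on differences,
`‖x n − y n‖ ≤ (Π_{k<n}(1 + ε_k) − 1)‖x 0‖`. [cite: HairerNorsettWanner1993, §II.3 Fig. 3.2, Thms 3.4–3.6 (method (b))] -/
theorem norm_sub_unperturbed_le_prod (M : ℕ → G → G) (x y e : ℕ → G) (ε : ℕ → ℝ)
    (hM : ∀ k u w, ‖M k u - M k w‖ ≤ ‖u - w‖) (hM0 : ∀ k, M k 0 = 0) (hε : ∀ k, 0 ≤ ε k)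
    (hx : ∀ k, x (k + 1) = M k (x k) + e k) (hy : ∀ k, y (k + 1) = M k (y k)) (h0 : y 0 = x 0)
    (he : ∀ k (C : ℝ), (∀ j ≤ k, ‖x j‖ ≤ C) → ‖e k‖ ≤ ε k * C) :
    ∀ n, ‖x n - y n‖ ≤ ((∏ k ∈ range n, (1 + ε k)) - 1) * ‖x 0‖ := by
  have hM' : ∀ k u, ‖M k u‖ ≤ ‖u‖ := fun k u => by simpa [hM0 k] using hM k u 0
  have hgrow := norm_le_prod_norm₀ M x e ε hM' hε hx he
  -- the whole past is bounded by the current product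
  have hpast : ∀ n, ∀ j ≤ n, ‖x j‖ ≤ (∏ k ∈ range n, (1 + ε k)) * ‖x 0‖ := fun n j hj =>
    (hgrow j).trans (mul_le_mul_of_nonneg_right (prod_one_add_mono ε hε hj) (norm_nonneg _))
  intro n
  induction n with
  | zero => simp [h0]
  | succ n ih =>
    rw [hx n, hy n, Finset.prod_range_succ]
    have h2 : ‖e n‖ ≤ ε n * ((∏ k ∈ range n, (1 + ε k)) * ‖x 0‖) := he n _ (hpast n)
    calc ‖M n (x n) + e n - M n (y n)‖ = ‖(M n (x n) - M n (y n)) + e n‖ := by abel_nf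
      _ ≤ ‖M n (x n) - M n (y n)‖ + ‖e n‖ := norm_add_le _ _
      _ ≤ ‖x n - y n‖ + ‖e n‖ := by gcongr; exact hM n _ _
      _ ≤ ((∏ k ∈ range n, (1 + ε k)) - 1) * ‖x 0‖ + ε n * ((∏ k ∈ range n, (1 + ε k)) * ‖x 0‖) :=
          add_le_add ih h2
      _ = ((∏ k ∈ range n, (1 + ε k)) * (1 + ε n) - 1) * ‖x 0‖ := by ring

/-- `Π_{k<n}(1 + ε_k) ≤ exp(Σ_{k<n} ε_k)` for `ε_k ≥ 0`. [folklore] -/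
private theorem prod_one_add_le_exp_sum (ε : ℕ → ℝ) (hε : ∀ k, 0 ≤ ε k) (n : ℕ) :
    ∏ k ∈ range n, (1 + ε k) ≤ Real.exp (∑ k ∈ range n, ε k) := by
  rw [Real.exp_sum]
  exact Finset.prod_le_prod (fun k _ => by linarith [hε k]) fun k _ => by
    have := Real.add_one_le_exp (ε k); linarith

/-- **Exponential form**: `‖x n − y n‖ ≤ (exp(Σ_{k<n} ε_k) − 1)‖x 0‖`.
[cite: HairerNorsettWanner1993, §II.3 Thm 3.6 (3.29)] -/
theorem norm_sub_unperturbed_le_exp (M : ℕ → G → G) (x y e : ℕ → G) (ε : ℕ → ℝ)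
    (hM : ∀ k u w, ‖M k u - M k w‖ ≤ ‖u - w‖) (hM0 : ∀ k, M k 0 = 0) (hε : ∀ k, 0 ≤ ε k)
    (hx : ∀ k, x (k + 1) = M k (x k) + e k) (hy : ∀ k, y (k + 1) = M k (y k)) (h0 : y 0 = x 0)
    (he : ∀ k (C : ℝ), (∀ j ≤ k, ‖x j‖ ≤ C) → ‖e k‖ ≤ ε k * C) :
    ∀ n, ‖x n - y n‖ ≤ (Real.exp (∑ k ∈ range n, ε k) - 1) * ‖x 0‖ := fun n =>
  (norm_sub_unperturbed_le_prod M x y e ε hM hM0 hε hx hy h0 he n).trans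
    (mul_le_mul_of_nonneg_right (by linarith [prod_one_add_le_exp_sum ε hε n]) (norm_nonneg _))

end PerturbedRecursion

end Literature.Analysis.ODE
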